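import Summits.Ventures.PercRepro.KroneckerPITDefs

/-!
# PercRepro — Kronecker polynomial identity testing, II: the expansion lemmas (p4, gen 27)

The formal expansion `toPoly` of an expression evaluates like the expression (`evalP_toPoly`), and its ℓ¹-norm and
degrees are dominated by the structural bounds `l1E`, `degAE`, `degBE` (`l1P_toPoly_le`, `degAP_toPoly_le`,
`degBP_toPoly_le`).  Used by `pitE` in KroneckerPIT.
-/

namespace PercRepro.PIT
section evalLemmas

variable {R : Type*} [CommRing R] (x y : R)

/-- Evaluation is additive over concatenation. -/
lemma evalP_append (p q : Poly) : evalP x y (p ++ q) = evalP x y p + evalP x y q := by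
  induction p with
  | nil => simp [evalP]
  | cons t p ih => obtain ⟨ea, eb, c⟩ := t; simp [evalP, ih]; ring

/-- Evaluation of a scaled polynomial. -/
lemma evalP_scale (t : Term) (q : Poly) :
    evalP x y (scaleP t q) = ((t.2.2 : R) * x ^ t.1 * y ^ t.2.1) * evalP x y q := by
  induction q with
  | nil => simp [scaleP, evalP]
  | cons s q ih =>
    obtain ⟨ea, eb, c⟩ := s
    simp only [scaleP, evalP, ih, Int.cast_mul, pow_add]
    ring

/-- Evaluation is multiplicative. -/
lemma evalP_mul (p q : Poly) : evalP x y (mulP p q) = evalP x y p * evalP x y q := by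
  induction p with
  | nil => simp [mulP, evalP]
  | cons t p ih =>
    obtain ⟨ea, eb, c⟩ := t
    simp only [mulP, evalP_append, evalP_scale, ih, evalP]
    ring

/-- Evaluation of the negation. -/
lemma evalP_neg (p : Poly) : evalP x y (negP p) = - evalP x y p := by
  induction p with
  | nil => simp [negP, evalP]
  | cons t p ih => obtain ⟨ea, eb, c⟩ := t; simp [negP, evalP, ih]; ring

/-- Evaluation of a power. -/
lemma evalP_pow (p : Poly) (n : Nat) : evalP x y (powP p n) = evalP x y p ^ n := by
  induction n with
  | zero => simp [powP, evalP]
  | succ n ih => simp [powP, evalP_mul, ih, pow_succ]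

/-- Evaluation of a substitution. -/
lemma evalP_subst (pa pb p : Poly) :
    evalP x y (substP pa pb p) = evalP (evalP x y pa) (evalP x y pb) p := by
  induction p with
  | nil => simp [substP, evalP]
  | cons t p ih =>
    obtain ⟨ea, eb, c⟩ := t
    simp only [substP, evalP_append, evalP_scale, evalP_mul, evalP_pow, ih, evalP]
    simp only [pow_zero, mul_one]
    ring

/-- The expansion evaluates like the expression. -/
lemma evalP_toPoly (e : PExpr) : evalP x y (toPoly e) = evalE x y e := by
  induction e with
  | leaf p => rfl
  | va => simp [toPoly, evalP, evalE]
  | vb => simp [toPoly, evalP, evalE]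
  | const c => simp [toPoly, evalP, evalE]
  | add e₁ e₂ ih₁ ih₂ => simp [toPoly, evalE, evalP_append, ih₁, ih₂]
  | mul e₁ e₂ ih₁ ih₂ => simp [toPoly, evalE, evalP_mul, ih₁, ih₂]
  | neg e ih => simp [toPoly, evalE, evalP_neg, ih]
  | comp p ea eb iha ihb => simp [toPoly, evalE, evalP_subst, iha, ihb]

end evalLemmas

/-! ## The bounds of the expansion -/

/-- ℓ¹-norm of a concatenation. -/
lemma l1P_append (p q : Poly) : l1P (p ++ q) = l1P p + l1P q := by
  induction p with
  | nil => simp [l1P]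
  | cons t p ih => obtain ⟨ea, eb, c⟩ := t; simp [l1P, ih]; ring

/-- ℓ¹-norm of a scaled polynomial. -/
lemma l1P_scale (t : Term) (q : Poly) : l1P (scaleP t q) = t.2.2.natAbs * l1P q := by
  induction q with
  | nil => simp [scaleP, l1P]
  | cons s q ih => obtain ⟨ea, eb, c⟩ := s; simp [scaleP, l1P, ih, Int.natAbs_mul]; ring

/-- ℓ¹-norm of a product (exact for the formal product). -/
lemma l1P_mul (p q : Poly) : l1P (mulP p q) = l1P p * l1P q := by
  induction p with
  | nil => simp [mulP, l1P]
  | cons t p ih => obtain ⟨ea, eb, c⟩ := t; simp [mulP, l1P_append, l1P_scale, ih, l1P]; ring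

/-- ℓ¹-norm of the negation. -/
lemma l1P_neg (p : Poly) : l1P (negP p) = l1P p := by
  induction p with
  | nil => simp [negP, l1P]
  | cons t p ih => obtain ⟨ea, eb, c⟩ := t; simp [negP, l1P, ih]

/-- ℓ¹-norm of a power. -/
lemma l1P_pow (p : Poly) (n : Nat) : l1P (powP p n) = l1P p ^ n := by
  induction n with
  | zero => simp [powP, l1P]
  | succ n ih => simp [powP, l1P_mul, ih, pow_succ]

/-- ℓ¹-norm of a substitution. -/
lemma l1P_subst (pa pb p : Poly) : l1P (substP pa pb p) = l1Comp (l1P pa) (l1P pb) p := by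
  induction p with
  | nil => simp [substP, l1P, l1Comp]
  | cons t p ih =>
    obtain ⟨ea, eb, c⟩ := t
    simp only [substP, l1P_append, l1P_scale, l1P_mul, l1P_pow, ih, l1Comp]
    ring

/-- `l1Comp` is monotone in the two bounds. -/
lemma l1Comp_mono {la la' lb lb' : Nat} (ha : la ≤ la') (hb : lb ≤ lb') (p : Poly) :
    l1Comp la lb p ≤ l1Comp la' lb' p := by
  induction p with
  | nil => simp [l1Comp]
  | cons t p ih =>
    obtain ⟨ea, eb, c⟩ := t
    simp only [l1Comp]
    have h1 : la ^ ea ≤ la' ^ ea := Nat.pow_le_pow_left ha ea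
    have h2 : lb ^ eb ≤ lb' ^ eb := Nat.pow_le_pow_left hb eb
    have := Nat.mul_le_mul (Nat.mul_le_mul (le_refl c.natAbs) h1) h2
    omega

/-- The structural ℓ¹ bound dominates the ℓ¹-norm of the expansion. -/
lemma l1P_toPoly_le (e : PExpr) : l1P (toPoly e) ≤ l1E e := by
  induction e with
  | leaf p => exact le_rfl
  | va => simp [toPoly, l1P, l1E]
  | vb => simp [toPoly, l1P, l1E]
  | const c => simp [toPoly, l1P, l1E]
  | add e₁ e₂ ih₁ ih₂ => simp only [toPoly, l1E, l1P_append]; omega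
  | mul e₁ e₂ ih₁ ih₂ => simp only [toPoly, l1E, l1P_mul]; exact Nat.mul_le_mul ih₁ ih₂
  | neg e ih => simpa [toPoly, l1E, l1P_neg] using ih
  | comp p ea eb iha ihb =>
    simp only [toPoly, l1E, l1P_subst]
    exact l1Comp_mono iha ihb p

/-- `b`-degree of a concatenation. -/
lemma degBP_append (p q : Poly) : degBP (p ++ q) = max (degBP p) (degBP q) := by
  induction p with
  | nil => simp [degBP]
  | cons t p ih => obtain ⟨ea, eb, c⟩ := t; simp [degBP, ih, max_assoc]

/-- `b`-degree of a scaled polynomial. -/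
lemma degBP_scale_le (t : Term) (q : Poly) : degBP (scaleP t q) ≤ t.2.1 + degBP q := by
  induction q with
  | nil => simp [scaleP, degBP]
  | cons s q ih => obtain ⟨ea, eb, c⟩ := s; simp only [scaleP, degBP]; omega

/-- `b`-degree of a product. -/
lemma degBP_mul_le (p q : Poly) : degBP (mulP p q) ≤ degBP p + degBP q := by
  induction p with
  | nil => simp [mulP, degBP]
  | cons t p ih =>
    obtain ⟨ea, eb, c⟩ := t
    simp only [mulP, degBP_append, degBP]
    have := degBP_scale_le (ea, eb, c) q
    simp only at this
    omega

/-- `b`-degree of the negation. -/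
lemma degBP_neg (p : Poly) : degBP (negP p) = degBP p := by
  induction p with
  | nil => simp [negP, degBP]
  | cons t p ih => obtain ⟨ea, eb, c⟩ := t; simp [negP, degBP, ih]

/-- `b`-degree of a power. -/
lemma degBP_pow_le (p : Poly) (n : Nat) : degBP (powP p n) ≤ n * degBP p := by
  induction n with
  | zero => simp [powP, degBP]
  | succ n ih =>
    simp only [powP]
    have := degBP_mul_le (powP p n) p
    calc degBP (mulP (powP p n) p) ≤ degBP (powP p n) + degBP p := this
      _ ≤ n * degBP p + degBP p := by omega
      _ = (n + 1) * degBP p := by ring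

/-- `b`-degree of a substitution. -/
lemma degBP_subst_le (pa pb p : Poly) :
    degBP (substP pa pb p) ≤ degAP p * degBP pa + degBP p * degBP pb := by
  induction p with
  | nil => simp [substP, degBP]
  | cons t p ih =>
    obtain ⟨ea, eb, c⟩ := t
    simp only [substP, degBP_append, degAP, degBP]
    have h1 := degBP_scale_le (0, 0, c) (mulP (powP pa ea) (powP pb eb))
    have h2 := degBP_mul_le (powP pa ea) (powP pb eb)
    have h3 := degBP_pow_le pa ea
    have h4 := degBP_pow_le pb eb
    simp only at h1
    have h5 : degBP (scaleP (0, 0, c) (mulP (powP pa ea) (powP pb eb))) ≤ ea * degBP pa + eb * degBP pb := by omega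
    have h6 : ea * degBP pa + eb * degBP pb ≤ max ea (degAP p) * degBP pa + max eb (degBP p) * degBP pb :=
      Nat.add_le_add (Nat.mul_le_mul_right _ (le_max_left _ _)) (Nat.mul_le_mul_right _ (le_max_left _ _))
    have h7 : degAP p * degBP pa + degBP p * degBP pb ≤ max ea (degAP p) * degBP pa + max eb (degBP p) * degBP pb :=
      Nat.add_le_add (Nat.mul_le_mul_right _ (le_max_right _ _)) (Nat.mul_le_mul_right _ (le_max_right _ _))
    omega

/-- The structural `b`-degree bound dominates the `b`-degree of the expansion. -/
lemma degBP_toPoly_le (e : PExpr) : degBP (toPoly e) ≤ degBE e := by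
  induction e with
  | leaf p => exact le_rfl
  | va => simp [toPoly, degBP, degBE]
  | vb => simp [toPoly, degBP, degBE]
  | const c => simp [toPoly, degBP, degBE]
  | add e₁ e₂ ih₁ ih₂ => simp only [toPoly, degBE, degBP_append]; omega
  | mul e₁ e₂ ih₁ ih₂ =>
    simp only [toPoly, degBE]
    exact (degBP_mul_le _ _).trans (Nat.add_le_add ih₁ ih₂)
  | neg e ih => simpa [toPoly, degBE, degBP_neg] using ih
  | comp p ea eb iha ihb =>
    simp only [toPoly, degBE]
    refine (degBP_subst_le _ _ _).trans ?_
    exact Nat.add_le_add (Nat.mul_le_mul_left _ iha) (Nat.mul_le_mul_left _ ihb)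

/-- `a`-degree of a concatenation. -/
lemma degAP_append (p q : Poly) : degAP (p ++ q) = max (degAP p) (degAP q) := by
  induction p with
  | nil => simp [degAP]
  | cons t p ih => obtain ⟨ea, eb, c⟩ := t; simp [degAP, ih, max_assoc]

/-- `a`-degree of a scaled polynomial. -/
lemma degAP_scale_le (t : Term) (q : Poly) : degAP (scaleP t q) ≤ t.1 + degAP q := by
  induction q with
  | nil => simp [scaleP, degAP]
  | cons s q ih => obtain ⟨ea, eb, c⟩ := s; simp only [scaleP, degAP]; omega

/-- `a`-degree of a product. -/
lemma degAP_mul_le (p q : Poly) : degAP (mulP p q) ≤ degAP p + degAP q := by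
  induction p with
  | nil => simp [mulP, degAP]
  | cons t p ih =>
    obtain ⟨ea, eb, c⟩ := t
    simp only [mulP, degAP_append, degAP]
    have := degAP_scale_le (ea, eb, c) q
    simp only at this
    omega

/-- `a`-degree of the negation. -/
lemma degAP_neg (p : Poly) : degAP (negP p) = degAP p := by
  induction p with
  | nil => simp [negP, degAP]
  | cons t p ih => obtain ⟨ea, eb, c⟩ := t; simp [negP, degAP, ih]

/-- `a`-degree of a power. -/
lemma degAP_pow_le (p : Poly) (n : Nat) : degAP (powP p n) ≤ n * degAP p := by
  induction n with
  | zero => simp [powP, degAP]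
  | succ n ih =>
    simp only [powP]
    have := degAP_mul_le (powP p n) p
    calc degAP (mulP (powP p n) p) ≤ degAP (powP p n) + degAP p := this
      _ ≤ n * degAP p + degAP p := by omega
      _ = (n + 1) * degAP p := by ring

/-- `a`-degree of a substitution. -/
lemma degAP_subst_le (pa pb p : Poly) :
    degAP (substP pa pb p) ≤ degAP p * degAP pa + degBP p * degAP pb := by
  induction p with
  | nil => simp [substP, degAP]
  | cons t p ih =>
    obtain ⟨ea, eb, c⟩ := t
    simp only [substP, degAP_append, degAP, degBP]
    have h1 := degAP_scale_le (0, 0, c) (mulP (powP pa ea) (powP pb eb))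
    have h2 := degAP_mul_le (powP pa ea) (powP pb eb)
    have h3 := degAP_pow_le pa ea
    have h4 := degAP_pow_le pb eb
    simp only at h1
    have h5 : degAP (scaleP (0, 0, c) (mulP (powP pa ea) (powP pb eb))) ≤ ea * degAP pa + eb * degAP pb := by omega
    have h6 : ea * degAP pa + eb * degAP pb ≤ max ea (degAP p) * degAP pa + max eb (degBP p) * degAP pb :=
      Nat.add_le_add (Nat.mul_le_mul_right _ (le_max_left _ _)) (Nat.mul_le_mul_right _ (le_max_left _ _))
    have h7 : degAP p * degAP pa + degBP p * degAP pb ≤ max ea (degAP p) * degAP pa + max eb (degBP p) * degAP pb :=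
      Nat.add_le_add (Nat.mul_le_mul_right _ (le_max_right _ _)) (Nat.mul_le_mul_right _ (le_max_right _ _))
    omega

/-- The structural `a`-degree bound dominates the `a`-degree of the expansion. -/
lemma degAP_toPoly_le (e : PExpr) : degAP (toPoly e) ≤ degAE e := by
  induction e with
  | leaf p => exact le_rfl
  | va => simp [toPoly, degAP, degAE]
  | vb => simp [toPoly, degAP, degAE]
  | const c => simp [toPoly, degAP, degAE]
  | add e₁ e₂ ih₁ ih₂ => simp only [toPoly, degAE, degAP_append]; omega
  | mul e₁ e₂ ih₁ ih₂ =>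
    simp only [toPoly, degAE]
    exact (degAP_mul_le _ _).trans (Nat.add_le_add ih₁ ih₂)
  | neg e ih => simpa [toPoly, degAE, degAP_neg] using ih
  | comp p ea eb iha ihb =>
    simp only [toPoly, degAE]
    refine (degAP_subst_le _ _ _).trans ?_
    exact Nat.add_le_add (Nat.mul_le_mul_left _ iha) (Nat.mul_le_mul_left _ ihb)

/-- every `a`-exponent of a term is at most `degAP`. -/
lemma le_degAP {p : Poly} {t : Term} (ht : t ∈ p) : t.1 ≤ degAP p := by
  induction p with
  | nil => simp at ht
  | cons s p ih =>
    obtain ⟨ea, eb, c⟩ := s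
    simp only [List.mem_cons] at ht
    simp only [degAP]
    rcases ht with rfl | ht
    · exact le_max_left _ _
    · exact (ih ht).trans (le_max_right _ _)

/-- every `b`-exponent of a term is at most `degBP`. -/
lemma le_degBP {p : Poly} {t : Term} (ht : t ∈ p) : t.2.1 ≤ degBP p := by
  induction p with
  | nil => simp at ht
  | cons s p ih =>
    obtain ⟨ea, eb, c⟩ := s
    simp only [List.mem_cons] at ht
    simp only [degBP]
    rcases ht with rfl | ht
    · exact le_max_left _ _
    · exact (ih ht).trans (le_max_right _ _)

end PercRepro.PIT
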